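import Summits.ResolutionOfSingularities.ResolutionOfSingularities.Theorems.EquisingularLiftEquisingularLiftNatCarrierCutsConeStep
import Summits.ResolutionOfSingularities.ResolutionOfSingularities.Theorems.EquisingularLiftEquisingularLiftNatTowerConeRound
import HarnessLib

/-!
# [OURS · L1 W4.5(b) · EL♮(3)] S6 (N3) POINTS CASE, brick (S1): the stalk generator of the EXCEPTIONAL DIVISOR of a blow-up with regular centre in a
# regular scheme is a PRIME element (the input «`w` prime» of res-L1-w45b-lead-2's route, STATUS 2026-08-27T21:14:43Z, steps (i)/(ii)/(v))

res-L1-w45b-stub-4 g8 (desk RE-DEAL 22:05:48Z: S6 (N3)+(N3′) points case; CUT `L/res-L1-w45b-stub-4/ShadowPointsCut.sig.lean`). OURS; NOT a statement of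
any manuscript; AI-written, weaker than expert review. No `sorry`; standard axioms. DEF-FREE. `--supports stmt-ResolutionOfSingularities-20148 --as helper`.

* `prime_of_isRegularLocalRing_quotient_span` (S1r, ring): `R ⧸ (w)` regular local and `w ≠ 0` ⇒ `Prime w` (regular local ⇒ domain ⇒ `(w)` prime).
* `exists_prime_stalkIdeal_comap_eq_span` (S1, scheme): for the blow-up `τ : X₂ → X` of a regular centre `𝒞` in the regular `X`, at every point `x′`
  of the exceptional divisor `V(𝒞·𝒪_{X₂})` the stalk `(𝒞·𝒪_{X₂})_{x′}` is generated by a prime element of `𝒪_{X₂,x′}` (Cartier: a non-zero-divisor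
  generator; Liu 8.1.19 (b): the exceptional divisor is regular, `IsBlowup.isRegular_subscheme_comap`).
[cite: Liu2002, Thm. 8.1.19] [cite: Matsumura1987, Thm. 14.3]
-/

set_option linter.dupNamespace false -- mandated namespace `Summit.<Summit>.<Problem>` of this single-conjunct summit

noncomputable section

open CategoryTheory CategoryTheory.Limits AlgebraicGeometry TopologicalSpace Topology IsLocalRing
open Literature.AlgebraicGeometry.Resolution
open AlgebraicGeometry.Scheme.IdealSheafData
open scoped nonZeroDivisors

namespace Summit.ResolutionOfSingularities.ResolutionOfSingularities.Cruxes.EquisingularLiftNat.Sections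

/-- **(S1r)** If `R ⧸ (w)` is a regular local ring and `w ≠ 0`, then `w` is a prime element. [cite: Matsumura1987, Thm. 14.3] [folklore] -/
theorem prime_of_isRegularLocalRing_quotient_span {R : Type*} [CommRing R] {w : R} (hw0 : w ≠ 0)
    [h : IsRegularLocalRing (R ⧸ Ideal.span {w})] : Prime w := by
  haveI : IsDomain (R ⧸ Ideal.span {w}) := isDomain_of_isRegularLocalRing _
  exact (Ideal.span_singleton_prime hw0).mp ((Ideal.Quotient.isDomain_iff_prime _).mp inferInstance)

/-- **(S1)** At a point of the exceptional divisor of the blow-up of a regular centre in a regular locally Noetherian scheme, the stalk of the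
exceptional ideal sheaf is generated by a PRIME element. [cite: Liu2002, Thm. 8.1.19] [OURS · L1 W4.5b] toward `stub_elnat_coneTowerPointResolution`
(stmt-ResolutionOfSingularities-20148); NOT a statement of the manuscript. -/
theorem exists_prime_stalkIdeal_comap_eq_span {X X₂ : Scheme.{0}} [IsLocallyNoetherian X] {τ : X₂ ⟶ X} {𝒞 : X.IdealSheafData}
    (hτ : IsBlowup τ 𝒞) (hX : Scheme.IsRegular X) (hC : Scheme.IsRegular 𝒞.subscheme) (x' : X₂)
    (hx' : x' ∈ ((𝒞.comap τ).support : Set X₂)) :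
    ∃ w : X₂.presheaf.stalk x', stalkIdeal (𝒞.comap τ) x' = Ideal.span {w} ∧ Prime w := by
  obtain ⟨u, hu, hspan⟩ := hτ.isEffectiveCartier.exists_stalkIdeal_eq_span x'
  refine ⟨u, hspan, ?_⟩
  have hu0 : u ≠ 0 := nonZeroDivisors.ne_zero hu
  -- the exceptional divisor is regular at `x'`
  have hEreg : Scheme.IsRegular (𝒞.comap τ).subscheme := hτ.isRegular_subscheme_comap hX hC
  obtain ⟨s, hs⟩ : x' ∈ Set.range (𝒞.comap τ).subschemeι := by
    rw [Scheme.IdealSheafData.range_subschemeι]; exact hx'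
  have h := (isRegularLocalRing_stalk_subscheme_iff _ s).mp (hEreg s)
  rw [show ((𝒞.comap τ).subschemeι.base s : X₂) = x' from hs, hspan] at h
  exact prime_of_isRegularLocalRing_quotient_span hu0

end Summit.ResolutionOfSingularities.ResolutionOfSingularities.Cruxes.EquisingularLiftNat.Sections

end
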